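import Mathlib
import Literature.LinearAlgebra.Matrix.ClassicalGroupsCenter
import HarnessLib

/-!
# `SU(n)` is not isomorphic to `SU(2)` for `n ≥ 3` — by the centre

A corollary of Curtis, *Matrix Groups*, Ch. VII §C Prop. 9 (`Center SU(n) = {ωI | ωⁿ = 1} ≅ ℤ/n`; tree:
`Literature.LinearAlgebra.Matrix.mem_center_specialUnitaryGroup_iff_exists_smul_one`): a group isomorphism maps the centre onto
the centre, the centre of `SU(2)` consists of involutions (`ω² = 1`), while for `n ≥ 3` the central element `e^{2πi/n} · 1`
of `SU(n)` has order `n ≥ 3`.  Hence there is no group isomorphism `SU(n) ≃* SU(2)` (`n ≥ 3`), a fortiori no topological-group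
isomorphism; and a topological group isomorphic to some `SU(n)`, `n ≥ 3`, is not isomorphic to `SU(2)` (the disjointness of the
`SU(2)` class and the `SU(n ≥ 3)` classes of compact simple groups used by the Yang–Mills ladder's case split).
Theorems only, no definition, no named fact.

* `exists_mem_center_specialUnitaryGroup_mul_self_ne_one` — for `n ≥ 3`, some central `z ∈ SU(n)` has `z * z ≠ 1`;
* `mul_self_eq_one_of_mem_center_specialUnitaryGroup_two` — every central element of `SU(2)` squares to `1`;
* `isEmpty_mulEquiv_specialUnitaryGroup_two`, `isEmpty_continuousMulEquiv_specialUnitaryGroup_two`,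
  `isEmpty_continuousMulEquiv_two_of_continuousMulEquiv_specialUnitaryGroup`.
-/

noncomputable section

open Matrix Complex

namespace Literature.LinearAlgebra.Matrix

/-- A group isomorphism maps central elements to central elements. [folklore] -/
private theorem map_mem_center_of_mulEquiv {G H : Type*} [Group G] [Group H] (e : G ≃* H) {z : G}
    (hz : z ∈ Subgroup.center G) : e z ∈ Subgroup.center H := by
  rw [Subgroup.mem_center_iff] at hz ⊢
  intro h
  have := congrArg e (hz (e.symm h))
  simpa only [map_mul, MulEquiv.apply_symm_apply] using this

/-- **For `n ≥ 3` the centre of `SU(n)` contains an element of order `> 2`**: the scalar matrix `ζ · 1` with `ζ = e^{2πi/n}`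
(a primitive `n`th root of unity, so `ζ² ≠ 1`). [cite: Curtis1984MatrixGroups, Ch. VII §C Prop. 9] -/
theorem exists_mem_center_specialUnitaryGroup_mul_self_ne_one {n : ℕ} (hn : 3 ≤ n) :
    ∃ z : Matrix.specialUnitaryGroup (Fin n) ℂ,
      z ∈ Subgroup.center (Matrix.specialUnitaryGroup (Fin n) ℂ) ∧ z * z ≠ 1 := by
  have hn0 : n ≠ 0 := by omega
  set ζ : ℂ := Complex.exp (2 * Real.pi * Complex.I / n) with hζ
  have hprim : IsPrimitiveRoot ζ n := Complex.isPrimitiveRoot_exp n hn0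
  have hnorm : ‖ζ‖ = 1 := hprim.norm'_eq_one hn0
  have hpow : ζ ^ n = 1 := hprim.pow_eq_one
  have hmem : ζ • (1 : Matrix (Fin n) (Fin n) ℂ) ∈ Matrix.specialUnitaryGroup (Fin n) ℂ := by
    rw [Matrix.mem_specialUnitaryGroup_iff, Matrix.mem_unitaryGroup_iff]
    refine ⟨?_, ?_⟩
    · rw [Matrix.star_eq_conjTranspose, Matrix.conjTranspose_smul, Matrix.conjTranspose_one,
        Matrix.smul_mul, Matrix.one_mul, smul_smul]
      have : ζ * star ζ = 1 := by
        rw [Complex.star_def, Complex.mul_conj, Complex.normSq_eq_norm_sq, hnorm]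
        norm_num
      rw [this, one_smul]
    · rw [Matrix.det_smul, Matrix.det_one, mul_one, Fintype.card_fin, hpow]
  refine ⟨⟨ζ • 1, hmem⟩, ?_, ?_⟩
  · exact mem_center_specialUnitaryGroup_iff_exists_smul_one.2 ⟨ζ, by rw [Fintype.card_fin, hpow], rfl⟩
  · intro h
    have hmat : (ζ • (1 : Matrix (Fin n) (Fin n) ℂ)) * (ζ • (1 : Matrix (Fin n) (Fin n) ℂ)) = 1 :=
      congrArg Subtype.val h
    rw [Matrix.smul_mul, Matrix.one_mul, smul_smul] at hmat
    have h00 := congrFun (congrFun hmat ⟨0, by omega⟩) ⟨0, by omega⟩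
    rw [Matrix.smul_apply, Matrix.one_apply_eq, smul_eq_mul, mul_one, ← pow_two] at h00
    have hdvd : n ∣ 2 := (hprim.pow_eq_one_iff_dvd 2).1 h00
    exact absurd (Nat.le_of_dvd two_pos hdvd) (by omega)

/-- **Every central element of `SU(2)` is an involution**: `Center SU(2) = {ωI | ω² = 1}`, so `z * z = 1`.
[cite: Curtis1984MatrixGroups, Ch. VII §C Prop. 9] -/
theorem mul_self_eq_one_of_mem_center_specialUnitaryGroup_two {z : Matrix.specialUnitaryGroup (Fin 2) ℂ}
    (hz : z ∈ Subgroup.center (Matrix.specialUnitaryGroup (Fin 2) ℂ)) : z * z = 1 := by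
  obtain ⟨ω, hω, hzω⟩ := mem_center_specialUnitaryGroup_iff_exists_smul_one.1 hz
  rw [Fintype.card_fin] at hω
  apply Subtype.ext
  change (z : Matrix (Fin 2) (Fin 2) ℂ) * (z : Matrix (Fin 2) (Fin 2) ℂ) = 1
  rw [hzω, Matrix.smul_mul, Matrix.one_mul, smul_smul, ← pow_two, hω, one_smul]

/-- **`SU(n)` and `SU(2)` are not isomorphic as groups for `n ≥ 3`** (centre `ℤ/n` versus `ℤ/2`).
[cite: Curtis1984MatrixGroups, Ch. VII §C Prop. 9] -/
theorem isEmpty_mulEquiv_specialUnitaryGroup_two {n : ℕ} (hn : 3 ≤ n) :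
    IsEmpty (Matrix.specialUnitaryGroup (Fin n) ℂ ≃* Matrix.specialUnitaryGroup (Fin 2) ℂ) := by
  refine ⟨fun e => ?_⟩
  obtain ⟨z, hz, hzz⟩ := exists_mem_center_specialUnitaryGroup_mul_self_ne_one hn
  have h1 : e z * e z = 1 := mul_self_eq_one_of_mem_center_specialUnitaryGroup_two (map_mem_center_of_mulEquiv e hz)
  rw [← map_mul, ← map_one e] at h1
  exact hzz (e.injective h1)

/-- No topological-group isomorphism `SU(n) ≃ₜ* SU(2)` for `n ≥ 3`. [cite: Curtis1984MatrixGroups, Ch. VII §C Prop. 9] -/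
theorem isEmpty_continuousMulEquiv_specialUnitaryGroup_two {n : ℕ} (hn : 3 ≤ n) :
    IsEmpty (Matrix.specialUnitaryGroup (Fin n) ℂ ≃ₜ* Matrix.specialUnitaryGroup (Fin 2) ℂ) :=
  ⟨fun e => (isEmpty_mulEquiv_specialUnitaryGroup_two hn).false e.toMulEquiv⟩

/-- **The `SU(2)` class and the `SU(n)` class (`n ≥ 3`) of topological groups are disjoint**: a topological group
isomorphic to `SU(n)`, `n ≥ 3`, admits no topological-group isomorphism onto `SU(2)`. [cite: Curtis1984MatrixGroups, Ch. VII §C Prop. 9] -/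
theorem isEmpty_continuousMulEquiv_two_of_continuousMulEquiv_specialUnitaryGroup {G : Type*} [Group G]
    [TopologicalSpace G] {n : ℕ} (hn : 3 ≤ n) (e : G ≃ₜ* Matrix.specialUnitaryGroup (Fin n) ℂ) :
    IsEmpty (G ≃ₜ* Matrix.specialUnitaryGroup (Fin 2) ℂ) :=
  ⟨fun e' => (isEmpty_mulEquiv_specialUnitaryGroup_two hn).false (e.symm.toMulEquiv.trans e'.toMulEquiv)⟩

/-! ## Revision 1 (appended 2026-08-26): the order of the centre, and `SU(n) ≄ SU(m)` for `n ≠ m`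

Curtis VII §C Prop. 9 in full strength on the cardinality side: `Z(SU(n)) = {ωI | ωⁿ = 1}` has exactly `n` elements (`n ≥ 1`;
Mathlib's `Complex.card_rootsOfUnity`), so the order of the centre is a group-isomorphism invariant separating `SU(n)` from `SU(m)` for
all `n ≠ m` — the classes `{G ≃ₜ* SU(n)}`, `n ≥ 1`, of topological groups are pairwise disjoint.

* `natCard_center_specialUnitaryGroup` — `Nat.card Z(SU(n)) = n` for a non-empty index type;
* `isEmpty_mulEquiv_specialUnitaryGroup_of_card_ne`, `isEmpty_continuousMulEquiv_specialUnitaryGroup_of_ne`,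
  `eq_of_continuousMulEquiv_specialUnitaryGroup` — non-isomorphism for distinct ranks, and uniqueness of the rank of an `SU`-class. -/

section CentreOrder

variable {n : Type*} [DecidableEq n] [Fintype n]

/-- A scalar matrix `ω • 1` with `ω ^ card n = 1` (`n` non-empty) lies in `SU(n)`: `|ω| = 1` gives unitarity, `det = ω ^ card n = 1`.
[cite: Curtis1984MatrixGroups, Ch. VII §C Prop. 9] -/
theorem smul_one_mem_specialUnitaryGroup_of_pow_card_eq_one [Nonempty n] {ω : ℂ} (hω : ω ^ Fintype.card n = 1) :
    ω • (1 : Matrix n n ℂ) ∈ Matrix.specialUnitaryGroup n ℂ := by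
  have hnorm : ‖ω‖ = 1 := Complex.norm_eq_one_of_pow_eq_one hω Fintype.card_ne_zero
  rw [Matrix.mem_specialUnitaryGroup_iff, Matrix.mem_unitaryGroup_iff]
  refine ⟨?_, ?_⟩
  · rw [Matrix.star_eq_conjTranspose, Matrix.conjTranspose_smul, Matrix.conjTranspose_one, Matrix.smul_mul, Matrix.one_mul,
      smul_smul]
    have : ω * star ω = 1 := by
      rw [Complex.star_def, Complex.mul_conj, Complex.normSq_eq_norm_sq, hnorm]
      norm_num
    rw [this, one_smul]
  · rw [Matrix.det_smul, Matrix.det_one, mul_one, hω]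

/-- **The centre of `SU(n)` has exactly `n` elements** (`n` = the cardinality of the non-empty index type): `Z(SU(n)) = {ωI | ωⁿ = 1}`
(`mem_center_specialUnitaryGroup_iff_exists_smul_one`) is in bijection with the `n`th roots of unity in `ℂ`, of which there are `n`
(`Complex.card_rootsOfUnity`). [cite: Curtis1984MatrixGroups, Ch. VII §C Prop. 9] -/
theorem natCard_center_specialUnitaryGroup [Nonempty n] :
    Nat.card (Subgroup.center (Matrix.specialUnitaryGroup n ℂ)) = Fintype.card n := by
  haveI : NeZero (Fintype.card n) := ⟨Fintype.card_ne_zero⟩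
  obtain ⟨i₀⟩ := ‹Nonempty n›
  -- the diagonal entry `z i₀ i₀` of a central `z = ω • 1` is `ω`, an `n`th root of unity
  have hdiag : ∀ z : Subgroup.center (Matrix.specialUnitaryGroup n ℂ),
      ((z : Matrix.specialUnitaryGroup n ℂ) : Matrix n n ℂ) = ((z : Matrix.specialUnitaryGroup n ℂ) : Matrix n n ℂ) i₀ i₀ • 1 ∧
        (((z : Matrix.specialUnitaryGroup n ℂ) : Matrix n n ℂ) i₀ i₀) ^ Fintype.card n = 1 := by
    intro z
    obtain ⟨ω, hω, hz⟩ := mem_center_specialUnitaryGroup_iff_exists_smul_one.1 z.2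
    have h00 : ((z : Matrix.specialUnitaryGroup n ℂ) : Matrix n n ℂ) i₀ i₀ = ω := by
      rw [hz, Matrix.smul_apply, Matrix.one_apply_eq, smul_eq_mul, mul_one]
    rw [h00]
    exact ⟨hz, hω⟩
  let e : Subgroup.center (Matrix.specialUnitaryGroup n ℂ) ≃ rootsOfUnity (Fintype.card n) ℂ :=
    { toFun := fun z => rootsOfUnity.mkOfPowEq _ (hdiag z).2
      invFun := fun ζ => ⟨⟨((ζ : ℂˣ) : ℂ) • 1,
          smul_one_mem_specialUnitaryGroup_of_pow_card_eq_one ((mem_rootsOfUnity' _ _).1 ζ.2)⟩,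
        mem_center_specialUnitaryGroup_iff_exists_smul_one.2 ⟨((ζ : ℂˣ) : ℂ), (mem_rootsOfUnity' _ _).1 ζ.2, rfl⟩⟩
      left_inv := fun z => by
        apply Subtype.ext
        apply Subtype.ext
        change (((z : Matrix.specialUnitaryGroup n ℂ) : Matrix n n ℂ) i₀ i₀) • (1 : Matrix n n ℂ) = _
        exact (hdiag z).1.symm
      right_inv := fun ζ => by
        apply Subtype.ext
        apply Units.ext
        rw [rootsOfUnity.coe_mkOfPowEq]
        change ((((ζ : ℂˣ) : ℂ) • (1 : Matrix n n ℂ)) i₀ i₀) = _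
        rw [Matrix.smul_apply, Matrix.one_apply_eq, smul_eq_mul, mul_one] }
  rw [Nat.card_congr e, Complex.card_rootsOfUnity]

/-- **`SU(n)` and `SU(m)` are not isomorphic as groups when `n ≠ m`** (non-empty index types): a group isomorphism restricts to a
bijection of the centres (`Subgroup.centerCongr`), whose orders are `n` and `m`. [cite: Curtis1984MatrixGroups, Ch. VII §C Prop. 9] -/
theorem isEmpty_mulEquiv_specialUnitaryGroup_of_card_ne {m : Type*} [DecidableEq m] [Fintype m] [Nonempty n] [Nonempty m]
    (h : Fintype.card n ≠ Fintype.card m) :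
    IsEmpty (Matrix.specialUnitaryGroup n ℂ ≃* Matrix.specialUnitaryGroup m ℂ) := by
  refine ⟨fun e => h ?_⟩
  rw [← natCard_center_specialUnitaryGroup (n := n), ← natCard_center_specialUnitaryGroup (n := m)]
  exact Nat.card_congr (Subgroup.centerCongr e).toEquiv

end CentreOrder

/-- **No topological-group isomorphism `SU(n) ≃ₜ* SU(m)` for `n ≠ m`, `n, m ≥ 1`** (orders of the centres).
[cite: Curtis1984MatrixGroups, Ch. VII §C Prop. 9] -/
theorem isEmpty_continuousMulEquiv_specialUnitaryGroup_of_ne {n m : ℕ} (hn : 1 ≤ n) (hm : 1 ≤ m) (h : n ≠ m) :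
    IsEmpty (Matrix.specialUnitaryGroup (Fin n) ℂ ≃ₜ* Matrix.specialUnitaryGroup (Fin m) ℂ) := by
  haveI : Nonempty (Fin n) := ⟨⟨0, hn⟩⟩
  haveI : Nonempty (Fin m) := ⟨⟨0, hm⟩⟩
  exact ⟨fun e => (isEmpty_mulEquiv_specialUnitaryGroup_of_card_ne (n := Fin n) (m := Fin m) (by simpa using h)).false
    e.toMulEquiv⟩

/-- **The rank of an `SU`-class is unique**: a topological group isomorphic to `SU(n)` and to `SU(m)` (`n, m ≥ 1`) has `n = m` — the
classes `{G ≃ₜ* SU(n)}` of topological groups, `n ≥ 1`, are pairwise disjoint. [cite: Curtis1984MatrixGroups, Ch. VII §C Prop. 9] -/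
theorem eq_of_continuousMulEquiv_specialUnitaryGroup {G : Type*} [Group G] [TopologicalSpace G] {n m : ℕ} (hn : 1 ≤ n)
    (hm : 1 ≤ m) (e : G ≃ₜ* Matrix.specialUnitaryGroup (Fin n) ℂ) (e' : G ≃ₜ* Matrix.specialUnitaryGroup (Fin m) ℂ) : n = m := by
  by_contra h
  exact (isEmpty_continuousMulEquiv_specialUnitaryGroup_of_ne hn hm h).false (e.symm.trans e')

end Literature.LinearAlgebra.Matrix

end
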